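/-
Copyright (c) 2026. All rights reserved.
Released under Apache 2.0 license as described in the file LICENSE.
Authors: abc-iut cell, prover seat abc-iut-w5-d038 (gen 8; row «ARC-MTC-F3» (L4-lead m134), tool for part F3b at the
vertex `mult`: objects of `TB⊞` are classified by the kernel of their parametrisation `(s, t) ↦ c₁(s) + c₂(t)`).
-/
import Literature.AnabelianGeometry.AbsoluteAnabelian.TBPlusCategory
import HarnessLib

/-!
# `TB⊞`: morphisms and isomorphisms from the parametrisation `ℝ × ℝ ↠ B` ([AbsTopIII] Def 5.6 (i))

S. Mochizuki, *Topics in absolute anabelian geometry III*, Def 5.6 (i) p. 134: an object `(B, B′, B″, β)` of `TB⊞` is a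
two-dimensional connected topological Lie group with two one-parameter subgroups which «determine an isomorphism
`B′ × B″ ⥲ B` of topological groups» [in the tree: the parametrisation `A_B : ℝ × ℝ → B`, `(s, t) ↦ c₁(s) + c₂(t)` is a
continuous OPEN SURJECTIVE homomorphism — abc-iut-L4-t3's fields `add_surjective`, `isOpenMap_add` of `TBPlus`]; a
morphism is a surjective continuous homomorphism carrying `B′ → B′`, `B″ → B″` with rescalings `a₁, a₂`.

Consequence typed here (the tool by which the archimedean `η⊢_{v,ν}` of Cor 5.10 (iv)(c) is built at the vertex
`mult`, where `B = k^×` is a quotient of `ℝ × ℝ` by `2πℤ × 0`): since `A_B` is a topological QUOTIENT map,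

* `TBPlus.paramHom M : ℝ × ℝ →ₜ+ B` — the parametrisation; `hom_ext_paramHom` — morphisms out of `M` are determined
  by their values on `c₁(s) + c₂(t)`;
* ★ `TBPlus.liftHom` / `TBPlus.homOfKernel` — a pair of nonzero scalars `(a₁, a₂)` whose diagonal action carries
  `Ker A_M` into `Ker A_N` INDUCES a morphism `M → N` of `TB⊞` with rescalings `a₁, a₂` (given `|a₂| β_M = β_N |a₁|`):
  `c₁(s) + c₂(t) ↦ c₁(a₁ s) + c₂(a₂ t)` — well defined, additive, continuous (`A_M` is a quotient map), surjective;
* ★★ `TBPlus.isoOfKernel` — if the diagonal action IDENTIFIES the kernels, the induced morphism is an ISOMORPHISM of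
  `TB⊞` (inverse: the morphism induced by `(a₁⁻¹, a₂⁻¹)`).

Definitions (the induced maps) with their laws proved; no instance, no named fact.  MODEL-LEVEL bookkeeping;
nothing here bears on the disputed [IUTchIII] Cor. 3.12; typed ≠ proved.
-/

set_option autoImplicit false

universe u

open CategoryTheory Topology

namespace Literature.AnabelianGeometry.AbsoluteAnabelian

namespace TBPlus

variable (M : TBPlus.{u})

/-! ## §1. The parametrisation `A_B : ℝ × ℝ ↠ B` -/

/-- **The parametrisation `A_B : ℝ × ℝ → B`, `(s, t) ↦ c₁(s) + c₂(t)`** («`B′ × B″ ⥲ B`»), a continuous homomorphism.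
[cite: MochizukiAbsTopIII2015, Def 5.6 (i) p. 134] -/
noncomputable def paramHom : ℝ × ℝ →ₜ+ M.B where
  toFun p := M.c₁ p.1 + M.c₂ p.2
  map_zero' := by rw [Prod.fst_zero, Prod.snd_zero, map_zero, map_zero, add_zero]
  map_add' p q := by rw [Prod.fst_add, Prod.snd_add, map_add, map_add, add_add_add_comm]
  continuous_toFun := (M.c₁.continuous.comp continuous_fst).add (M.c₂.continuous.comp continuous_snd)

/-- `A_B` on elements. [cite: MochizukiAbsTopIII2015, Def 5.6 (i) p. 134] -/
@[simp] theorem paramHom_apply (p : ℝ × ℝ) : M.paramHom p = M.c₁ p.1 + M.c₂ p.2 := rfl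

/-- `A_B(s, 0) = c₁(s)`. [cite: MochizukiAbsTopIII2015, Def 5.6 (i) p. 134] -/
theorem paramHom_inl (s : ℝ) : M.paramHom (s, 0) = M.c₁ s := by
  rw [paramHom_apply, map_zero, add_zero]

/-- `A_B(0, t) = c₂(t)`. [cite: MochizukiAbsTopIII2015, Def 5.6 (i) p. 134] -/
theorem paramHom_inr (t : ℝ) : M.paramHom (0, t) = M.c₂ t := by
  rw [paramHom_apply, map_zero, zero_add]

/-- `A_B` is onto. [cite: MochizukiAbsTopIII2015, Def 5.6 (i) p. 134] -/
theorem paramHom_surjective : Function.Surjective M.paramHom := M.add_surjective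

/-- `A_B` is an open map. [cite: MochizukiAbsTopIII2015, Def 5.6 (i) p. 134] -/
theorem isOpenMap_paramHom : IsOpenMap M.paramHom := M.isOpenMap_add

/-- **`A_B` is a topological quotient map** (continuous, open, onto). [cite: MochizukiAbsTopIII2015, Def 5.6 (i) p. 134] -/
theorem isQuotientMap_paramHom : IsQuotientMap M.paramHom :=
  M.isOpenMap_paramHom.isQuotientMap M.paramHom.continuous M.paramHom_surjective

variable {M} {N : TBPlus.{u}}

/-- **Morphisms out of `M` are determined by their values on the parametrisation.**
[cite: MochizukiAbsTopIII2015, Def 5.6 (i) p. 134] -/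
theorem hom_ext_paramHom {f g : M ⟶ N} (h : ∀ p : ℝ × ℝ, f.toHom (M.paramHom p) = g.toHom (M.paramHom p)) : f = g := by
  refine hom_ext_toHom (ContinuousAddMonoidHom.ext fun b => ?_)
  obtain ⟨p, rfl⟩ := M.paramHom_surjective b
  exact h p

/-! ## §2. The morphism induced by a diagonal action carrying `Ker A_M` into `Ker A_N` -/

/-- The diagonal action `(s, t) ↦ (a₁ s, a₂ t)` of a pair of scalars on `ℝ × ℝ`. [cite: MochizukiAbsTopIII2015, Def 5.6 (i) p. 134] -/
def diag (a₁ a₂ : ℝ) (p : ℝ × ℝ) : ℝ × ℝ := (a₁ * p.1, a₂ * p.2)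

/-- `diag` on elements. [cite: MochizukiAbsTopIII2015, Def 5.6 (i) p. 134] -/
@[simp] theorem diag_apply (a₁ a₂ : ℝ) (p : ℝ × ℝ) : diag a₁ a₂ p = (a₁ * p.1, a₂ * p.2) := rfl

/-- `diag` is additive. [cite: MochizukiAbsTopIII2015, Def 5.6 (i) p. 134] -/
theorem diag_add (a₁ a₂ : ℝ) (p q : ℝ × ℝ) : diag a₁ a₂ (p + q) = diag a₁ a₂ p + diag a₁ a₂ q := by
  simp only [diag_apply, Prod.fst_add, Prod.snd_add, mul_add, Prod.mk_add_mk]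

/-- `diag` is compatible with subtraction. [cite: MochizukiAbsTopIII2015, Def 5.6 (i) p. 134] -/
theorem diag_sub (a₁ a₂ : ℝ) (p q : ℝ × ℝ) : diag a₁ a₂ (p - q) = diag a₁ a₂ p - diag a₁ a₂ q := by
  simp only [diag_apply, Prod.fst_sub, Prod.snd_sub, mul_sub, Prod.mk_sub_mk]

/-- `diag` is continuous. [cite: MochizukiAbsTopIII2015, Def 5.6 (i) p. 134] -/
theorem continuous_diag (a₁ a₂ : ℝ) : Continuous (diag a₁ a₂) :=
  (continuous_const.mul continuous_fst).prodMk (continuous_const.mul continuous_snd)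

/-- **A morphism of `TB⊞` on the parametrisation**: `f(A_M(s, t)) = A_N(a₁ s, a₂ t)`. [cite: MochizukiAbsTopIII2015, Def 5.6 (i) p. 134] -/
theorem toHom_paramHom (f : M ⟶ N) (p : ℝ × ℝ) : f.toHom (M.paramHom p) = N.paramHom (diag f.a₁ f.a₂ p) := by
  rw [paramHom_apply, paramHom_apply, map_add, f.map_c₁, f.map_c₂, diag_apply]

/-- Inverse scalars undo the diagonal action. [cite: MochizukiAbsTopIII2015, Def 5.6 (i) p. 134] -/
theorem diag_inv_diag {a₁ a₂ : ℝ} (h₁ : a₁ ≠ 0) (h₂ : a₂ ≠ 0) (p : ℝ × ℝ) : diag a₁⁻¹ a₂⁻¹ (diag a₁ a₂ p) = p := by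
  simp only [diag_apply, ← mul_assoc, inv_mul_cancel₀ h₁, inv_mul_cancel₀ h₂, one_mul]

/-- The diagonal action undoes the inverse scalars. [cite: MochizukiAbsTopIII2015, Def 5.6 (i) p. 134] -/
theorem diag_diag_inv {a₁ a₂ : ℝ} (h₁ : a₁ ≠ 0) (h₂ : a₂ ≠ 0) (p : ℝ × ℝ) : diag a₁ a₂ (diag a₁⁻¹ a₂⁻¹ p) = p := by
  simp only [diag_apply, ← mul_assoc, mul_inv_cancel₀ h₁, mul_inv_cancel₀ h₂, one_mul]

section Lift

variable (M N) (a₁ a₂ : ℝ) (hker : ∀ p : ℝ × ℝ, M.paramHom p = 0 → N.paramHom (diag a₁ a₂ p) = 0)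

include hker in
/-- The induced map on a parametrised element does not depend on the parametrisation.
[cite: MochizukiAbsTopIII2015, Def 5.6 (i) p. 134] -/
theorem paramHom_diag_eq_of_paramHom_eq {p q : ℝ × ℝ} (h : M.paramHom p = M.paramHom q) :
    N.paramHom (diag a₁ a₂ p) = N.paramHom (diag a₁ a₂ q) := by
  have h0 : M.paramHom (p - q) = 0 := by rw [map_sub, h, sub_self]
  have h1 := hker _ h0
  rwa [diag_sub, map_sub, sub_eq_zero] at h1

/-- The underlying function of the induced morphism: `b = A_M(p) ↦ A_N(a₁ p₁, a₂ p₂)` (a parametrisation of `b` chosen).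
[cite: MochizukiAbsTopIII2015, Def 5.6 (i) p. 134] -/
noncomputable def liftFun (b : M.B) : N.B :=
  N.paramHom (diag a₁ a₂ (Classical.choose (M.paramHom_surjective b)))

include hker

/-- **The induced map on the parametrisation**: `A_M(p) ↦ A_N(a₁ p₁, a₂ p₂)`. [cite: MochizukiAbsTopIII2015, Def 5.6 (i) p. 134] -/
theorem liftFun_paramHom (p : ℝ × ℝ) : liftFun M N a₁ a₂ (M.paramHom p) = N.paramHom (diag a₁ a₂ p) :=
  paramHom_diag_eq_of_paramHom_eq M N a₁ a₂ hker (Classical.choose_spec (M.paramHom_surjective (M.paramHom p)))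

/-- ★ **The induced continuous homomorphism `B_M → B_N`** (additive since `A_M, A_N, diag` are; continuous because
`A_M` is a topological quotient map and the composite with it is `A_N ∘ diag`). [cite: MochizukiAbsTopIII2015, Def 5.6 (i) p. 134] -/
noncomputable def liftHom : M.B →ₜ+ N.B where
  toFun := liftFun M N a₁ a₂
  map_zero' := by
    rw [← map_zero M.paramHom, liftFun_paramHom M N a₁ a₂ hker]
    simp only [diag_apply, Prod.fst_zero, Prod.snd_zero, mul_zero, Prod.mk_zero_zero, map_zero]
  map_add' b b' := by
    obtain ⟨p, rfl⟩ := M.paramHom_surjective b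
    obtain ⟨q, rfl⟩ := M.paramHom_surjective b'
    rw [← map_add, liftFun_paramHom M N a₁ a₂ hker, liftFun_paramHom M N a₁ a₂ hker,
      liftFun_paramHom M N a₁ a₂ hker, diag_add, map_add]
  continuous_toFun := by
    rw [M.isQuotientMap_paramHom.continuous_iff]
    have h : liftFun M N a₁ a₂ ∘ M.paramHom = N.paramHom ∘ diag a₁ a₂ :=
      funext fun p => liftFun_paramHom M N a₁ a₂ hker p
    rw [h]
    exact N.paramHom.continuous.comp (continuous_diag a₁ a₂)

/-- The induced homomorphism on the parametrisation. [cite: MochizukiAbsTopIII2015, Def 5.6 (i) p. 134] -/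
theorem liftHom_paramHom (p : ℝ × ℝ) : liftHom M N a₁ a₂ hker (M.paramHom p) = N.paramHom (diag a₁ a₂ p) :=
  liftFun_paramHom M N a₁ a₂ hker p

/-- `B′ → B′`: `c₁(s) ↦ c₁(a₁ s)`. [cite: MochizukiAbsTopIII2015, Def 5.6 (i) p. 134] -/
theorem liftHom_c₁ (s : ℝ) : liftHom M N a₁ a₂ hker (M.c₁ s) = N.c₁ (a₁ * s) := by
  rw [← paramHom_inl, liftHom_paramHom, diag_apply, mul_zero, paramHom_inl]

/-- `B″ → B″`: `c₂(t) ↦ c₂(a₂ t)`. [cite: MochizukiAbsTopIII2015, Def 5.6 (i) p. 134] -/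
theorem liftHom_c₂ (t : ℝ) : liftHom M N a₁ a₂ hker (M.c₂ t) = N.c₂ (a₂ * t) := by
  rw [← paramHom_inr, liftHom_paramHom, diag_apply, mul_zero, paramHom_inr]

/-- The induced homomorphism is onto when the scalars are nonzero. [cite: MochizukiAbsTopIII2015, Def 5.6 (i) p. 134] -/
theorem liftHom_surjective (h₁ : a₁ ≠ 0) (h₂ : a₂ ≠ 0) : Function.Surjective (liftHom M N a₁ a₂ hker) := by
  intro b
  obtain ⟨q, rfl⟩ := N.paramHom_surjective b
  exact ⟨M.paramHom (diag a₁⁻¹ a₂⁻¹ q), by rw [liftHom_paramHom, diag_diag_inv h₁ h₂]⟩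

/-- ★ **The morphism of `TB⊞` induced by a diagonal action carrying `Ker A_M` into `Ker A_N`**, rescalings `a₁, a₂`.
[cite: MochizukiAbsTopIII2015, Def 5.6 (i) p. 134] -/
noncomputable def homOfKernel (h₁ : a₁ ≠ 0) (h₂ : a₂ ≠ 0) (hβ : |a₂| * M.β = N.β * |a₁|) : M ⟶ N where
  toHom := liftHom M N a₁ a₂ hker
  surjective := liftHom_surjective M N a₁ a₂ hker h₁ h₂
  a₁ := a₁
  a₂ := a₂
  map_c₁ := liftHom_c₁ M N a₁ a₂ hker
  map_c₂ := liftHom_c₂ M N a₁ a₂ hker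
  map_β := hβ

/-- The induced morphism on the parametrisation. [cite: MochizukiAbsTopIII2015, Def 5.6 (i) p. 134] -/
theorem homOfKernel_toHom_paramHom (h₁ : a₁ ≠ 0) (h₂ : a₂ ≠ 0) (hβ : |a₂| * M.β = N.β * |a₁|) (p : ℝ × ℝ) :
    (homOfKernel M N a₁ a₂ hker h₁ h₂ hβ).toHom (M.paramHom p) = N.paramHom (diag a₁ a₂ p) :=
  liftHom_paramHom M N a₁ a₂ hker p

/-- The induced morphism rescales `B′` by `a₁`. [cite: MochizukiAbsTopIII2015, Def 5.6 (i) p. 134] -/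
@[simp] theorem homOfKernel_a₁ (h₁ : a₁ ≠ 0) (h₂ : a₂ ≠ 0) (hβ : |a₂| * M.β = N.β * |a₁|) :
    (homOfKernel M N a₁ a₂ hker h₁ h₂ hβ).a₁ = a₁ := rfl

/-- The induced morphism rescales `B″` by `a₂`. [cite: MochizukiAbsTopIII2015, Def 5.6 (i) p. 134] -/
@[simp] theorem homOfKernel_a₂ (h₁ : a₁ ≠ 0) (h₂ : a₂ ≠ 0) (hβ : |a₂| * M.β = N.β * |a₁|) :
    (homOfKernel M N a₁ a₂ hker h₁ h₂ hβ).a₂ = a₂ := rfl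

end Lift

/-! ## §3. Identified kernels: the induced ISOMORPHISM -/

/-- The `β`-compatibility for the inverse scalars. [cite: MochizukiAbsTopIII2015, Def 5.6 (i) p. 134] -/
theorem β_inv {a₁ a₂ : ℝ} (h₁ : a₁ ≠ 0) (h₂ : a₂ ≠ 0) (hβ : |a₂| * M.β = N.β * |a₁|) :
    |a₂⁻¹| * N.β = M.β * |a₁⁻¹| := by
  rw [abs_inv, abs_inv]
  have ha₁ : |a₁| ≠ 0 := abs_ne_zero.2 h₁
  have ha₂ : |a₂| ≠ 0 := abs_ne_zero.2 h₂
  field_simp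
  linarith [hβ]

section Iso

variable (M N) (a₁ a₂ : ℝ) (hker : ∀ p : ℝ × ℝ, M.paramHom p = 0 ↔ N.paramHom (diag a₁ a₂ p) = 0)
  (h₁ : a₁ ≠ 0) (h₂ : a₂ ≠ 0) (hβ : |a₂| * M.β = N.β * |a₁|)
include hker h₁ h₂

/-- The kernel condition for the inverse scalars, from the identification of kernels.
[cite: MochizukiAbsTopIII2015, Def 5.6 (i) p. 134] -/
theorem kernel_inv (q : ℝ × ℝ) (hq : N.paramHom q = 0) : M.paramHom (diag a₁⁻¹ a₂⁻¹ q) = 0 := by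
  rw [hker, diag_diag_inv h₁ h₂]
  exact hq

include hβ

/-- ★★ **Identified kernels give an ISOMORPHISM of `TB⊞`** `M ⥲ N` with rescalings `a₁, a₂` (inverse: the morphism
induced by `a₁⁻¹, a₂⁻¹`). [cite: MochizukiAbsTopIII2015, Def 5.6 (i) p. 134] -/
noncomputable def isoOfKernel : M ≅ N :=
  isoMk (homOfKernel M N a₁ a₂ (fun p hp => (hker p).1 hp) h₁ h₂ hβ)
    (homOfKernel N M a₁⁻¹ a₂⁻¹ (kernel_inv M N a₁ a₂ hker h₁ h₂) (inv_ne_zero h₁) (inv_ne_zero h₂)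
      (β_inv h₁ h₂ hβ))
    (fun b => by
      obtain ⟨p, rfl⟩ := M.paramHom_surjective b
      rw [homOfKernel_toHom_paramHom, homOfKernel_toHom_paramHom, diag_inv_diag h₁ h₂])
    (fun b => by
      obtain ⟨q, rfl⟩ := N.paramHom_surjective b
      rw [homOfKernel_toHom_paramHom, homOfKernel_toHom_paramHom, diag_diag_inv h₁ h₂])

/-- The isomorphism on the parametrisation: `A_M(p) ↦ A_N(a₁ p₁, a₂ p₂)`. [cite: MochizukiAbsTopIII2015, Def 5.6 (i) p. 134] -/
theorem isoOfKernel_hom_toHom_paramHom (p : ℝ × ℝ) :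
    (isoOfKernel M N a₁ a₂ hker h₁ h₂ hβ).hom.toHom (M.paramHom p) = N.paramHom (diag a₁ a₂ p) :=
  liftHom_paramHom M N a₁ a₂ (fun p hp => (hker p).1 hp) p

/-- The inverse on the parametrisation: `A_N(q) ↦ A_M(a₁⁻¹ q₁, a₂⁻¹ q₂)`. [cite: MochizukiAbsTopIII2015, Def 5.6 (i) p. 134] -/
theorem isoOfKernel_inv_toHom_paramHom (q : ℝ × ℝ) :
    (isoOfKernel M N a₁ a₂ hker h₁ h₂ hβ).inv.toHom (N.paramHom q) = M.paramHom (diag a₁⁻¹ a₂⁻¹ q) :=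
  liftHom_paramHom N M a₁⁻¹ a₂⁻¹ (kernel_inv M N a₁ a₂ hker h₁ h₂) q

/-- The isomorphism rescales `B′` by `a₁`. [cite: MochizukiAbsTopIII2015, Def 5.6 (i) p. 134] -/
@[simp] theorem isoOfKernel_hom_a₁ : (isoOfKernel M N a₁ a₂ hker h₁ h₂ hβ).hom.a₁ = a₁ := rfl

/-- The isomorphism rescales `B″` by `a₂`. [cite: MochizukiAbsTopIII2015, Def 5.6 (i) p. 134] -/
@[simp] theorem isoOfKernel_hom_a₂ : (isoOfKernel M N a₁ a₂ hker h₁ h₂ hβ).hom.a₂ = a₂ := rfl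

/-- The inverse rescales `B′` by `a₁⁻¹`. [cite: MochizukiAbsTopIII2015, Def 5.6 (i) p. 134] -/
@[simp] theorem isoOfKernel_inv_a₁ : (isoOfKernel M N a₁ a₂ hker h₁ h₂ hβ).inv.a₁ = a₁⁻¹ := rfl

/-- The inverse rescales `B″` by `a₂⁻¹`. [cite: MochizukiAbsTopIII2015, Def 5.6 (i) p. 134] -/
@[simp] theorem isoOfKernel_inv_a₂ : (isoOfKernel M N a₁ a₂ hker h₁ h₂ hβ).inv.a₂ = a₂⁻¹ := rfl

end Iso

end TBPlus

end Literature.AnabelianGeometry.AbsoluteAnabelian
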